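import Summits.BirchSwinnertonDyer.BirchSwinnertonDyer.Theorems.SmallImageMuTransferMuTransferX9LocalExponentBadPrimesCurve
import Literature.NumberTheory.GaloisCohomology.PoitouTate
import Literature.NumberTheory.GaloisRepresentations.LocalEulerPoincareCharacteristic
import HarnessLib

/-!
# K6 crux `MuTransferX9` (stmt-BirchSwinnertonDyer-19276), stub `stub_selmerDualOdd` (skeleton v6):
# the local clause (L-bad) — at every `v ∤ p`, a uniform `T`-exponent killing `H¹(ℚ_v, 𝒯_J(E, κ⁻¹))`
# — DISCHARGED from k6-g4's uniform local exponent (`…X9LocalExponentBadPrimesCurve`)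

Cell `bsd-smallim`, seat `bsd-smallim-k6-c2` (gen 3). HONEST FRAMING: theorems only; nothing asserted,
nothing booked. `localBad` is hypothesis `hLbad` of `SelmerDual.stub_selmerDualOdd_of_local`
(`…X9SelmerDualAssembly.lean`) VERBATIM: for the cyclotomic `κ` and a finite place `v ∤ p` of `ℚ` there is
`ε_v` with `loc_v (T^{ε_v} c) = 0` for every class `c` of every level of the dual twist.  It is k6-g4's
`LocalSplitPrime.exists_uniform_localization_shiftH1_modPTwist_invTwist_of_isCyclotomic` (p453009; #H¹(ℚ_v,
𝒯_J) bounded uniformly in `J` by the local Euler characteristic and (2,0)-duality, `v` not splitting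
completely in the cyclotomic tower) at the singleton `{v}`.  The unused binders (`γ`, irreducibility,
(EP), (PT)) are the stub's prefix.

PARTITION (D-0054): X9 (A4) × p ∈ {5,7} (+ X10b∧¬Surj at 3) — helper toward `stub_selmerDualOdd`; closes none.

References: J. S. Milne, *Arithmetic Duality Theorems* I Thm. 2.8 [MilneADT2006]; R. Greenberg, LNM 1716 §1
[GreenbergLNM1716]; HOME/koly/MU-TRANSFER-PROOF.md (F6).
-/

set_option linter.dupNamespace false
set_option autoImplicit false

noncomputable section

open scoped NumberField
open Field IsDedekindDomain
open Literature.NumberTheory.GaloisRepresentations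
open Literature.NumberTheory.GaloisCohomology
open Literature.NumberTheory.EllipticCurves

namespace Summit.BirchSwinnertonDyer.BirchSwinnertonDyer.Rank1Residual.SelmerDual

/-- **(L-bad) of `stub_selmerDualOdd_of_local`, discharged**: at every place `v ∤ p` there is a uniform
`ε_v` with `loc_v ((κ⁻¹.shiftH1)^[ε_v] c) = 0` for all levels `J` and all `c ∈ H¹(ℚ, 𝒯_J(E, κ⁻¹))`
(k6-g4's uniform local exponent at the singleton `{v}`).
[cite: MilneADT2006, Ch. I §2, Thm. 2.8 (p. 31)] [cite: GreenbergLNM1716, §1] -/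
theorem localBad :
    ∀ (W : WeierstrassCurve ℚ) [W.IsElliptic] [W.IsGloballyMinimal] (p : ℕ) [Fact p.Prime]
      (κ : ZpExtension ℚ p) (γ : absoluteGaloisGroup ℚ),
      p ≠ 2 → W.HasIrreducibleModPGaloisRep p → ¬ W.HasSurjectiveModNGaloisRep p →
      κ.IsCyclotomic → κ.IsTopGenerator γ →
      (∀ v : HeightOneSpectrum (𝓞 ℚ), localEulerPoincareCharacteristic (v.adicCompletion ℚ)) →
      poitouTate_sum_localTatePairing_eq_zero ℚ →
      ∀ v : HeightOneSpectrum (𝓞 ℚ), ((p : ℕ) : 𝓞 ℚ) ∉ v.asIdeal →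
        ∃ εv : ℕ, ∀ (J : ℕ) (c : galoisCohomology (W.modPTwist p κ.invTwist J) 1),
          galoisCohomology.localization (W.modPTwist p κ.invTwist J) (Sum.inr v) 1
            ((κ.invTwist.shiftH1 (W.torsionGaloisModule (p : ℤ))
              (fun P : WeierstrassCurve.geomTorsion W (p : ℤ) => AddSubgroup.torsionBy.nsmul P) J)^[εv] c) = 0 := by
  intro W _ _ p _ κ _ _ _ _ hκ _ _ _ v hv
  obtain ⟨ε, hε⟩ :=
    LocalSplitPrime.exists_uniform_localization_shiftH1_modPTwist_invTwist_of_isCyclotomic W p κ hκ {v}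
      (fun v' hv' => by rwa [Finset.mem_singleton.mp hv'])
  exact ⟨ε, fun J c => hε le_rfl v (Finset.mem_singleton_self v) J c⟩

end Summit.BirchSwinnertonDyer.BirchSwinnertonDyer.Rank1Residual.SelmerDual

end
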